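/-
Copyright (c) 2026 the pub-hodgecm-mathlib formalisation cell (harness21).  Prover seat hodgecm-mathlib-K2E1-p15 (g3), Track B ∕ K2-LIT, h413 = `stmt-HodgeConjecture-24833`,
R90-TF section S8 «ContSpec-n½» (planner R90-CS-plan (g0), deal (A) 2026-09-04T16:23:19Z; this seat's LAYER-2 scoping 16:27:11Z, LAYER 1b): the DENSITY letter (D) of the #4 assembly
★ `R90S8LeClosureOfBlockLetters.le_topologicalClosure_of_block_letters` reduced to IRREDUCIBILITY — an irreducible closed subrepresentation is the closed span of any non-zero
`G`-permuted family of its subspaces (e.g. its `(K′,ω)`-isotypic pieces).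
-/
import Literature.NumberTheory.Automorphic.HilbertRepSpectrumProofs   -- ★ `ClosedSubrep.eq_of_le_of_isTopIrreducible`; brings ★ `HilbertRepSpectrum` (`ClosedSubrep`, `IsTopIrreducible`)
import HarnessLib

/-!
# S8 #4 road, LAYER 1b — `R90S8DenseOfIrreducibleLetters`: in a topologically irreducible closed subrepresentation `P`, a `G`-permuted family of subspaces `Q_i ≤ P` with one `Q_i ≠ 0`
# spans a DENSE subspace: `P ≤ closure ⨆_i Q_i`

Track B ∕ K2-LIT, crux h413 = `stmt-HodgeConjecture-24833`, route of record `HCCMUnconditional`; cell `hodgecm-mathlib`, R90-TF programme, section S8 «ContSpec-n½», socket #4 road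
(`sock_S8_resH_spannedByCharLines`): letter (D) «`P ≤ closure ⨆_{(K′,ω)} (P ∩ L²^{(K′,ω)})`» of LAYER 1 (★ p861918).  GENERIC (topological modules over a ring; no inner product, no
completeness); THEOREMS ONLY (no `def`, no `instance`, no `notation`, no named-fact hypothesis, no `sorry`; default heartbeats); lane `--supports stmt-HodgeConjecture-24833 --as helper`
(count-neutral).  Closes no socket.

THE MATHEMATICS ([Dixmier1977, §13.1.5]; [BrockerTomDieck1985, III (5.7)] for the use with `K`-types).  Let `π` be a representation of `G` on `V`, `P ≤ V` a closed invariant subspace on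
which `π` is topologically irreducible, and `(Q_i)_i` subspaces of `P` such that every `π(g)` maps each `Q_i` into `Σ_j Q_j` (the family is `G`-PERMUTED — e.g. `Q_{(K′,ω)} = P ∩ V^{(K′,ω)}`
with `g·V^{(K′,ω)} = V^{(gK′g⁻¹, ω^g)}`).  Then `M := closure (Σ_i Q_i)` is a closed `π`-invariant subspace of `P` (invariance passes to the span and, by continuity of `π(g)`, to the
closure); if some `Q_i ≠ 0` then `M ≠ 0`, so `M = P` by irreducibility (★ `ClosedSubrep.eq_of_le_of_isTopIrreducible`): **`P ≤ closure Σ_i Q_i`**.  For #4 at `U(Φ₂)`: the non-zero piece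
is a `K′_f`-fixed vector (Alaoglu–Birkhoff, ★ `exists_levelBlock_ne_zero`) split into `K_∞`-eigencomponents (`K_∞` compact abelian at `N = 2`), so (D) costs no Peter–Weyl density theorem.
* §1 **`le_topologicalClosure_iSup_of_isTopIrreducible`** — THE HEAD (letter (D) from irreducibility), and `toSubmodule_eq_topologicalClosure_iSup_of_isTopIrreducible` (equality form).
HONEST LABEL: HC_CM is proved only modulo the 7 printed citations (2 remaining named inputs: hLiu418 = `stmt-HodgeConjecture-24832`, h413 = `stmt-HodgeConjecture-24833`) until
rung 0 closes; REL ≠ ★ ≠ BUILT; this file asserts no named fact and closes no socket; count-neutral.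

## References
* [Dixmier1977] J. Dixmier, *C\*-algebras* (North-Holland, 1977), §13.1.5 (topological irreducibility).
* [BrockerTomDieck1985] T. Bröcker, T. tom Dieck, *Representations of Compact Lie Groups* (Springer, 1985), III (5.7).
-/

set_option autoImplicit false
set_option linter.dupNamespace false  -- the mandated namespace `…HodgeConjecture.HodgeConjecture.R90.S8` (LEAD #1 L1) repeats the summit's segment

noncomputable section

namespace Summit.HodgeConjecture.HodgeConjecture.R90.S8

open ContRepresentation

variable {R G V : Type*} [Ring R] [Monoid G] [AddCommGroup V] [TopologicalSpace V] [IsTopologicalAddGroup V] [T1Space V]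
  [Module R V] [ContinuousConstSMul R V] {π : ContRepresentation R G V}

/-! ## §1 Letter (D) from irreducibility -/

/-- **An irreducible closed subrepresentation is the closed span of any non-zero `G`-permuted family of its subspaces (equality form).**  For `P` topologically irreducible, subspaces
`Q i ≤ P` with `π(g)(Q_i) ≤ ⨆_j Q_j` for all `g, i` and some `Q_i ≠ ⊥`: `P = closure ⨆_i Q_i` as submodules — the closure is a closed invariant subspace of `P` (span + continuity), non-zero,
hence all of `P` (★ `ClosedSubrep.eq_of_le_of_isTopIrreducible`). [cite: Dixmier1977, §13.1.5] -/
theorem toSubmodule_eq_topologicalClosure_iSup_of_isTopIrreducible (P : ClosedSubrep π) (hP : P.toContRep.IsTopIrreducible)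
    {ι : Type*} (Q : ι → Submodule R V) (hQ : ∀ i, Q i ≤ P.toSubmodule)
    (hinv : ∀ (g : G) (i : ι), (Q i).map (π g : V →ₗ[R] V) ≤ ⨆ j, Q j) (hne : ∃ i, Q i ≠ ⊥) :
    P.toSubmodule = (⨆ i, Q i).topologicalClosure := by
  -- the span is invariant
  have hspan : ∀ g : G, (⨆ i, Q i).map (π g : V →ₗ[R] V) ≤ ⨆ j, Q j := fun g => by
    rw [Submodule.map_iSup]
    exact iSup_le fun i => hinv g i
  -- the closed span, as a closed subrepresentation
  let M : ClosedSubrep π :=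
    { toSubmodule := (⨆ i, Q i).topologicalClosure
      apply_mem_toSubmodule := fun g v hv => by
        have hmaps : Set.MapsTo (π g) ((⨆ i, Q i : Submodule R V) : Set V) ((⨆ i, Q i : Submodule R V) : Set V) :=
          fun x hx => hspan g (Submodule.mem_map_of_mem hx)
        have hcl := hmaps.closure (π g).continuous
        rw [← Submodule.topologicalClosure_coe] at hcl
        exact hcl hv
      isClosed' := Submodule.isClosed_topologicalClosure _ }
  -- `M ≤ P` (`P` is closed) and `M ≠ 0`
  have hMP : M ≤ P := by
    rw [← ClosedSubrep.toSubmodule_le_iff]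
    exact Submodule.topologicalClosure_minimal _ (iSup_le hQ) P.isClosed
  have hMnt : Nontrivial M.toSubmodule := by
    obtain ⟨i, hi⟩ := hne
    obtain ⟨v, hv, hv0⟩ := (Submodule.ne_bot_iff _).mp hi
    have hvM : v ∈ M.toSubmodule := Submodule.le_topologicalClosure _ (Submodule.mem_iSup_of_mem i hv)
    exact ⟨⟨⟨v, hvM⟩, 0, fun h => hv0 (congrArg Subtype.val h)⟩⟩
  -- irreducibility
  have hMeq : M = P := ClosedSubrep.eq_of_le_of_isTopIrreducible hP hMnt hMP
  exact (congrArg (fun W : ClosedSubrep π => W.toSubmodule) hMeq).symm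

/-- **LETTER (D) — `P ≤ closure ⨆_i Q_i`** for an irreducible closed subrepresentation `P` and a non-zero `G`-permuted family of subspaces `Q_i ≤ P` (e.g. the `(K′,ω)`-isotypic pieces
`P ∩ V^{(K′,ω)}`): the density input of ★ `le_topologicalClosure_of_block_letters` with NO Peter–Weyl theorem. [cite: Dixmier1977, §13.1.5] [cite: BrockerTomDieck1985, III (5.7)] -/
theorem le_topologicalClosure_iSup_of_isTopIrreducible (P : ClosedSubrep π) (hP : P.toContRep.IsTopIrreducible)
    {ι : Type*} (Q : ι → Submodule R V) (hQ : ∀ i, Q i ≤ P.toSubmodule)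
    (hinv : ∀ (g : G) (i : ι), (Q i).map (π g : V →ₗ[R] V) ≤ ⨆ j, Q j) (hne : ∃ i, Q i ≠ ⊥) :
    P.toSubmodule ≤ (⨆ i, Q i).topologicalClosure :=
  (toSubmodule_eq_topologicalClosure_iSup_of_isTopIrreducible P hP Q hQ hinv hne).le

end Summit.HodgeConjecture.HodgeConjecture.R90.S8

end
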